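import Mathlib

/-!
# NPL classifier budget — DEQ-A77B, Lemma D and eq. (4) (receipt; statement level + short proof)

HONEST FRAMING: instance-level adjudication of specific advantage claims; no claim about
BQP vs BPP or the summit.

Source: Leditto–Southwell–Usman–Modi, arXiv:2604.20108v1, Task 2 / Theorem 2 / Algorithm 2
(NPL certification: decide `K_q < K^s_q` under the promise `|K_q − K^s_q| ≥ Δ`, where
`n_q (K^s_q)^2 = Q`).  DEQ-A77B (pub-qadeq-deq-1/DEQ-A77B.md) Lemma D: a RELATIVE bracket
`(1-ε)Q ≤ Q̃ ≤ (1+ε)Q` with `ε (K+Δ)^2 ≤ KΔ/2` plus an ADDITIVE bracket `|Q̂ − Q̃| ≤ n_q K Δ`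
suffice to decide by the threshold `n_q (K^2 + Δ^2)`.  `nplClassicalSampleBudget` records the
sample count of Theorem A77B eq. (4); note that it has no argument for `n_k` or `n_q`
(the number of simplices) — the point of the theorem.

Intended tree location (to be filed by a permitted role, not by a planner seat):
`lean/Summits/QuantumAdvantage/Dequantization/NPLClassifierBudget.lean`.
-/

namespace Summit.QuantumAdvantage.Dequantization

/-- DEQ-A77B Lemma D (decision from a relatively-then-additively bracketed estimate).
`nq` = number of q-simplices (only as the scale of the threshold), `K` = coupling `K_q`,
`Δ` = promise gap, `Ks` = the simplicial critical coupling `K^s_q ≥ 0`, `Q = nq * Ks^2`,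
`Qt` = the polynomial surrogate `c^T r(L_q) c`, `Qh` = its Monte-Carlo estimate. -/
theorem npl_decision_correct
    (nq K Δ Ks Q Qt Qh ε : ℝ)
    (hnq : 0 < nq) (hK : 0 < K) (hΔ : 0 < Δ) (hΔK : Δ < K) (hKs : 0 ≤ Ks)
    (hQ : Q = nq * Ks ^ 2)
    (hprom : K + Δ ≤ Ks ∨ Ks ≤ K - Δ)
    (hε0 : 0 ≤ ε) (hεb : ε * (K + Δ) ^ 2 ≤ K * Δ / 2)
    (hrel1 : (1 - ε) * Q ≤ Qt) (hrel2 : Qt ≤ (1 + ε) * Q)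
    (hadd : |Qh - Qt| ≤ nq * K * Δ) :
    (nq * (K ^ 2 + Δ ^ 2) < Qh) ↔ (K < Ks) := by
  have hpos : 0 < (K + Δ) ^ 2 := by positivity
  have hε1 : ε ≤ 1 := by
    by_contra h
    push Not at h
    have : (1 : ℝ) * (K + Δ) ^ 2 < ε * (K + Δ) ^ 2 := mul_lt_mul_of_pos_right h hpos
    nlinarith
  have hnKΔ : 0 < nq * K * Δ := by positivity
  obtain ⟨hlo, hhi⟩ := abs_le.mp hadd
  rcases hprom with hyes | hno
  · -- YES instance: `K^s ≥ K + Δ`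
    have hKs2 : (K + Δ) ^ 2 ≤ Ks ^ 2 := pow_le_pow_left₀ (by linarith) hyes 2
    have hQlo : nq * (K + Δ) ^ 2 ≤ Q := by rw [hQ]; exact mul_le_mul_of_nonneg_left hKs2 hnq.le
    have h1 : (1 - ε) * (nq * (K + Δ) ^ 2) ≤ (1 - ε) * Q :=
      mul_le_mul_of_nonneg_left hQlo (sub_nonneg.mpr hε1)
    have hεn : nq * (ε * (K + Δ) ^ 2) ≤ nq * (K * Δ / 2) := mul_le_mul_of_nonneg_left hεb hnq.le
    refine iff_of_true ?_ (by linarith)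
    nlinarith
  · -- NO instance: `K^s ≤ K − Δ`
    have hKs2 : Ks ^ 2 ≤ (K - Δ) ^ 2 := pow_le_pow_left₀ hKs hno 2
    have hQhi : Q ≤ nq * (K - Δ) ^ 2 := by rw [hQ]; exact mul_le_mul_of_nonneg_left hKs2 hnq.le
    have h2 : (1 + ε) * Q ≤ (1 + ε) * (nq * (K - Δ) ^ 2) :=
      mul_le_mul_of_nonneg_left hQhi (by linarith)
    have h3 : ε * (K - Δ) ^ 2 ≤ ε * (K + Δ) ^ 2 := mul_le_mul_of_nonneg_left (by nlinarith) hε0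
    have hεn : nq * (ε * (K - Δ) ^ 2) ≤ nq * (K * Δ / 2) :=
      mul_le_mul_of_nonneg_left (h3.trans hεb) hnq.le
    refine iff_of_false ?_ (by push Not; linarith)
    push Not
    nlinarith

/-- The relative-error budget of DEQ-A77B §3.1: with `x = Δ/K`, `ε_r = x / (2 (1+x)^2)` satisfies
the hypothesis `ε (K+Δ)^2 ≤ KΔ/2` of `npl_decision_correct` (with equality). -/
theorem eps_r_budget (K Δ : ℝ) (hK : 0 < K) (hΔ : 0 < Δ) :
    (Δ / K) / (2 * (1 + Δ / K) ^ 2) * (K + Δ) ^ 2 = K * Δ / 2 := by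
  have hK0 : K ≠ 0 := hK.ne'
  have h1 : (1 + Δ / K) = (K + Δ) / K := by field_simp
  rw [h1]
  have hKD : K + Δ ≠ 0 := by positivity
  field_simp

/-- Sample count of Theorem A77B, eq. (4): `G · N₁` with `G = ⌈8 ln(1/δ)⌉` groups (median of means)
and `N₁ = ⌈4 C(r)^2 m δ_max n Γ^2 (K_q/Δ)^2⌉` samples per group, written as a real upper bound.
Arguments: failure probability `δ`, walk-coefficient norm `C = C(r)`, `m ∈ {k+1, k+2}`,
max up-degree `δmax < n`, number of vertices `n`, `Γ = N(ω^k)^2/(n_q K_q^2)`, `KoverΔ = K_q/Δ`.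
There is deliberately NO argument for the number of k- or q-simplices. -/
noncomputable def nplClassicalSampleBudget (δ C m δmax n Γ KoverΔ : ℝ) : ℝ :=
  (8 * Real.log (1 / δ) + 1) * (4 * C ^ 2 * m * δmax * n * Γ ^ 2 * KoverΔ ^ 2 + 1)

/-- The budget of eq. (4) is monotone in the walk-coefficient norm `C` (for `0 < δ ≤ 1` and
nonnegative size parameters): a larger `C(r)` can only increase the sample count. -/
theorem nplClassicalSampleBudget_mono_C {δ C C' m δmax n Γ KoverΔ : ℝ}
    (hδ : 0 < δ) (hδ1 : δ ≤ 1) (hm : 0 ≤ m) (hd : 0 ≤ δmax) (hn : 0 ≤ n)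
    (hC : 0 ≤ C) (hCC : C ≤ C') :
    nplClassicalSampleBudget δ C m δmax n Γ KoverΔ ≤ nplClassicalSampleBudget δ C' m δmax n Γ KoverΔ := by
  unfold nplClassicalSampleBudget
  have hlog : 0 ≤ Real.log (1 / δ) := Real.log_nonneg ((one_le_div hδ).mpr hδ1)
  have hC2 : C ^ 2 ≤ C' ^ 2 := pow_le_pow_left₀ hC hCC 2
  have : 4 * C ^ 2 * m * δmax * n * Γ ^ 2 * KoverΔ ^ 2 ≤ 4 * C' ^ 2 * m * δmax * n * Γ ^ 2 * KoverΔ ^ 2 := by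
    have h0 : 0 ≤ 4 * m * δmax * n * Γ ^ 2 * KoverΔ ^ 2 := by positivity
    nlinarith
  have hG : 0 ≤ 8 * Real.log (1 / δ) + 1 := by linarith
  exact mul_le_mul_of_nonneg_left (by linarith) hG

end Summit.QuantumAdvantage.Dequantization
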